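import Mathlib.Data.Nat.Log
import Mathlib.Data.Nat.Size
import Literature.Computability.Complexity.NTIMEHierarchyClock
import Literature.Computability.Complexity.PRelHierarchy
import Literature.Computability.Complexity.Classes
import HarnessLib

/-!
# Route UniformStream, crux `UniformMagnification` (stmt-PneNP-16047), line `registered`,
# stub `stub_seed`: the seed machine

**Theorem** (`stub_seed`). For a time-constructible `s`, ONE bundled `TM2` machine writes, from
the binary numeral `bin N = encodeNat N` (least significant digit first, `|bin N| = Nat.size N`),
the seed `⟨⟨tail (bin N), 1^{s ⌊log₂ N⌋}⟩, bin N⟩` within `s(⌊log₂ N⌋)^c + c` steps, for one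
constant `c` and every `N`.

Proof. The machine is the composite (`Turing.TM2ComputableAux.comp`, additive running time,
`Turing.TM2ComputableAux.comp_outputsWithin`) of

* a polynomial-time machine for `x ↦ ⟨tail x, x⟩` (`pairFn List.tail id ∈ FP` by `pairFn_mem_FP`,
  `PRelSigma.tail_mem_FP`, `PolyTimeComputable.id`), and
* `mapFstAux N_s` (`outputsWithin_mapFstAux`, `readRest_boolPair`) for the unary clock
  `N_s : y ↦ ⟨y, 1^{s |y|}⟩` of `exists_unaryClock_of_timeConstructible` (`a · s |y| + a` steps;
  this is where `IsTimeConstructible s` is consumed).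

On `x = bin N` the intermediate word is `⟨tail x, x⟩`, the clock runs on `tail x`, of length
`n := Nat.size N - 1 = ⌊log₂ N⌋` (`length_tail_encodeNat`), and the output is the seed. Every cost
is polynomial in `|x| ≤ n + 1 ≤ s n + 1` (`n ≤ s n` is part of `IsTimeConstructible s`), i.e.
at most `A (s n + 1)^D + A`, and `A (S + 1)^D + A ≤ S^c + c` for `c = A 2^D + 2A + 2D + 1`
(`mul_succ_pow_add_le_pow_add`).

References: S. Arora, B. Barak, *Computational Complexity: A Modern Approach*, CUP 2009, §1.3
(time-constructible functions; composition of machines, Claim 1.6); D. M. McKay, C. D. Murray,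
R. R. Williams, *Weak lower bounds on resource-bounded compression imply strong separations of
complexity classes*, STOC 2019, §4 (the seed of Algorithm 1).
-/

namespace Summit.PneNP.PneNP.Cruxes.UniformMagnification.Birth

set_option linter.dupNamespace false -- `Summit.PneNP.PneNP.…`: summit = sub-problem (D-0017)

open _root_.Computability Literature.Computability.Complexity

/-! ### Arithmetic -/

/-- `|tail (bin N)| = ⌊log₂ N⌋`: `|bin N| = Nat.size N = ⌊log₂ N⌋ + 1` for `N ≠ 0`, and both sides
vanish at `N = 0`. [folklore] -/
theorem length_tail_encodeNat (N : ℕ) : (encodeNat N).tail.length = Nat.log 2 N := by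
  rw [List.length_tail, TM2Pass.length_encodeNat_eq_size]
  rcases Nat.eq_zero_or_pos N with rfl | hN
  · simp
  · have h1 : Nat.size N ≤ Nat.log 2 N + 1 :=
      Nat.size_le.2 (Nat.lt_pow_succ_log_self one_lt_two N)
    have h2 : Nat.log 2 N < Nat.size N := Nat.lt_size.2 (Nat.pow_log_le_self 2 hN.ne')
    omega

/-- Absorption of constants into the route budget `S^c + c`: for all `A, D` there is `c` with
`A (S + 1)^D + A ≤ S^c + c` for every `S` (`c = A 2^D + 2A + 2D + 1`: for `S ≤ 1` the left side is
at most `A 2^D + A ≤ c`; for `S ≥ 2`, `A ≤ 2^A ≤ S^A` and `(S+1)^D ≤ S^{2D}`). [folklore] -/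
theorem mul_succ_pow_add_le_pow_add (A D : ℕ) :
    ∃ c : ℕ, ∀ S : ℕ, A * (S + 1) ^ D + A ≤ S ^ c + c := by
  refine ⟨A * 2 ^ D + A + (A + 2 * D + 1), fun S => ?_⟩
  rcases Nat.lt_or_ge S 2 with hS | hS
  · have h1 : (S + 1) ^ D ≤ 2 ^ D := Nat.pow_le_pow_left (by omega) D
    have h2 := Nat.mul_le_mul_left A h1
    have h3 : 0 ≤ S ^ (A * 2 ^ D + A + (A + 2 * D + 1)) := Nat.zero_le _
    omega
  · have hA : A ≤ S ^ A := (Nat.lt_two_pow_self).le.trans (Nat.pow_le_pow_left hS A)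
    have hD : (S + 1) ^ D ≤ S ^ (2 * D) :=
      calc (S + 1) ^ D ≤ (S * S) ^ D := Nat.pow_le_pow_left (by nlinarith) D
        _ = S ^ (2 * D) := by rw [pow_mul, sq]
    have h3 : A * (S + 1) ^ D + A ≤ S ^ (A + 2 * D + 1) :=
      calc A * (S + 1) ^ D + A ≤ S ^ A * S ^ (2 * D) + S ^ A * S ^ (2 * D) := by
            have h4 := Nat.mul_le_mul hA hD
            have h5 : S ^ A ≤ S ^ A * S ^ (2 * D) := Nat.le_mul_of_pos_right _ (by positivity)
            omega
        _ = 2 * S ^ (A + 2 * D) := by ring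
        _ ≤ S * S ^ (A + 2 * D) := Nat.mul_le_mul_right _ hS
        _ = S ^ (A + 2 * D + 1) := by ring
    calc A * (S + 1) ^ D + A ≤ S ^ (A + 2 * D + 1) := h3
      _ ≤ S ^ (A * 2 ^ D + A + (A + 2 * D + 1)) := Nat.pow_le_pow_right (by omega) (by omega)
      _ ≤ _ := Nat.le_add_right _ _

/-! ### The machines -/

/-- A polynomial-time machine for `x ↦ ⟨tail x, x⟩` (`pairFn List.tail id ∈ FP`).
[cite: AroraBarakCC2009, §1.3] -/
theorem exists_machine_tailPair :
    ∃ (p : Polynomial ℕ) (M : Turing.TM2ComputableAux Bool Bool), ∀ x : List Bool,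
      M.OutputsWithin x (boolPair x.tail x) (p.eval x.length) := by
  have hid : (fun w : List Bool => w) ∈ FP := PolyTimeComputable.id _
  obtain ⟨p, M, hM⟩ := pairFn_mem_FP PRelSigma.tail_mem_FP hid
  refine ⟨p, M, fun x => ?_⟩
  have h := hM x
  simp only [id, pairFn_apply] at h
  exact h

/-- **`stub_seed`** — the seed `⟨⟨tail (bin N), 1^{s(⌊log₂N⌋)}⟩, bin N⟩` is written by ONE `TM2`
machine from `bin N` within `s(⌊log₂N⌋)^c + c` steps: the machine for `x ↦ ⟨tail x, x⟩`, then
`mapFstAux` of the unary clock `y ↦ ⟨y, 1^{s |y|}⟩` of `s` (`exists_unaryClock_of_timeConstructible`),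
composed with additive running times; `|tail (bin N)| = ⌊log₂ N⌋`, and every cost is polynomial in
`s n ≥ n`, hence `≤ s(n)^c + c`. [cite: AroraBarakCC2009, §1.3] -/
theorem stub_seed (s : ℕ → ℕ) (hs : IsTimeConstructible s) :
    ∃ (c : ℕ) (M : Turing.TM2ComputableAux Bool Bool), ∀ N : ℕ,
      M.OutputsWithin (encodeNat N)
        (boolPair (boolPair (encodeNat N).tail (List.replicate (s (Nat.log 2 N)) true)) (encodeNat N))
        (s (Nat.log 2 N) ^ c + c) := by
  obtain ⟨p, M₁, hM₁⟩ := exists_machine_tailPair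
  obtain ⟨Nc, a, hNc⟩ := exists_unaryClock_of_timeConstructible hs
  obtain ⟨a₁, d, hp⟩ := exists_eval_le_mul_pow_add p
  obtain ⟨c, hc⟩ := mul_succ_pow_add_le_pow_add (a₁ + a + 40) (d + 1)
  refine ⟨c, M₁.comp (mapFstAux Nc), fun N => ?_⟩
  have htail : (encodeNat N).tail.length = Nat.log 2 N := length_tail_encodeNat N
  have hxlen : (encodeNat N).length ≤ Nat.log 2 N + 1 := TM2Pass.length_encodeNat_le N
  have hsn : Nat.log 2 N ≤ s (Nat.log 2 N) := hs.1 _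
  -- stage 2: the clock on the first component of `⟨tail x, x⟩`
  have h2 : (mapFstAux Nc).OutputsWithin (boolPair (encodeNat N).tail (encodeNat N))
      (boolPair (boolPair (encodeNat N).tail (List.replicate (s (Nat.log 2 N)) true)) (encodeNat N))
      ((a * s (Nat.log 2 N) + a)
        + 3 * (boolPair (encodeNat N).tail (List.replicate (s (Nat.log 2 N)) true)).length
        + 2 * (boolPair (encodeNat N).tail (encodeNat N)).length + 6) := by
    have hz : Nc.OutputsWithin (boolUnpair (boolPair (encodeNat N).tail (encodeNat N))).1
        (boolPair (encodeNat N).tail (List.replicate (s (Nat.log 2 N)) true))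
        (a * s (Nat.log 2 N) + a) := by
      rw [boolUnpair_boolPair]
      have h := hNc (encodeNat N).tail
      rwa [htail] at h
    have h := outputsWithin_mapFstAux Nc hz
    rwa [readRest_boolPair] at h
  have h := Turing.TM2ComputableAux.comp_outputsWithin _ _ (hM₁ (encodeNat N)) h2
  refine h.mono (le_trans ?_ (hc (s (Nat.log 2 N))))
  -- arithmetic: everything is polynomial in `s n + 1`
  simp only [length_boolPair, List.length_replicate, htail]
  have hpx := hp (encodeNat N).length
  have e1 : (encodeNat N).length ^ d ≤ (s (Nat.log 2 N) + 1) ^ (d + 1) :=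
    (Nat.pow_le_pow_left (by omega) d).trans (Nat.pow_le_pow_right (by omega) (by omega))
  have e2 : s (Nat.log 2 N) + 1 ≤ (s (Nat.log 2 N) + 1) ^ (d + 1) := Nat.le_self_pow (by omega) _
  have e3 := Nat.mul_le_mul_left a₁ e1
  have e4 := Nat.mul_le_mul_left (a + 40) e2
  nlinarith [e3, e4, hpx, hsn, hxlen]

end Summit.PneNP.PneNP.Cruxes.UniformMagnification.Birth
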